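import Literature.AnabelianGeometry.AbsoluteAnabelian.AbsTopISemiAbsolute
import Literature.AnabelianGeometry.AbsoluteAnabelian.GaloisSubextensionProofs
import HarnessLib

/-!
# [AbsTopI] Prop 1.3 (ii): very elastic ⟺ no non-trivial t.f.g. closed normal subgroups of open subgroups

S. Mochizuki, *Topics in Absolute Anabelian Geometry I: Generalities* (2012) [AbsTopI] (lit key
`paper:url-11ac98ba15fc`), Prop 1.3 (ii) p. 12: "Suppose that `G` is nontrivial. Then `G` is very
elastic if and only if it holds that every topologically finitely generated closed normal subgroup
`N ⊆ H` of an open subgroup `H ⊆ G` of `G` is trivial."  Printed proof (p. 12): "The necessity portion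
of assertion (ii) follows from the fact that the existence of a topologically finitely generated open
subgroup of `G` implies that `G` itself is topologically finitely generated; the sufficiency portion of
assertion (ii) follows immediately by taking `N := G ≠ {1}`."

PROOF-ONLY file (no definition, no named fact) over the typed vocabulary of
`AbsTopISemiAbsolute.lean` (`IsElastic`, `IsVeryElastic`, [AbsTopI] Def 1.1 (ii)) and
`ProfiniteTerminology.lean` (`IsTopologicallyFinitelyGenerated`, [AbsTopI] §0; transport lemma
`IsTopologicallyFinitelyGenerated.of_continuousMulEquiv` of `GaloisSubextensionProofs.lean`):

* `IsTopologicallyFinitelyGenerated.of_subgroup_of_isOpen` — the §0 fact the printed proof quotes: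
  **a compact group with a topologically finitely generated OPEN subgroup is itself topologically
  finitely generated** (generators: those of `U` together with a set of coset representatives of the
  finite set `G/U`);
* `IsVeryElastic.eq_bot_of_isOpen` — necessity: in a very elastic compact group every topologically
  finitely generated closed normal subgroup `N ⊆ H` of an open subgroup `H` is trivial (elasticity
  leaves `N = 1` or `[G : N] < ∞`; in the latter case `N` is open and t.f.g., so `G` would be t.f.g.);
* `isVeryElastic_of_forall_eq_bot` — sufficiency for non-trivial `G` (elastic trivially; not t.f.g.
  by taking `H = N = G`);
* `isVeryElastic_iff_forall_eq_bot` — **Prop 1.3 (ii)** for non-trivial compact `G`.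

Compactness is print's standing hypothesis ("`G` a profinite group", §1 p. 10); Hausdorffness and
total disconnectedness are not used.  [AbsTopI] Prop 1.3 is not an item cited by [IUTchI–IV]
(no DAG node); classical; OUR kernel check of a refereed printed claim; nothing here bears on
[IUTchIII] Cor. 3.12.
-/

noncomputable section

open Topology

universe u

namespace Literature.AnabelianGeometry.AbsoluteAnabelian

variable {G : Type u} [Group G] [TopologicalSpace G] [IsTopologicalGroup G]

/-- **[AbsTopI] §0 / proof of Prop 1.3 (ii): a compact group admitting a topologically finitely
generated open subgroup is topologically finitely generated.**  If `U ⊆ G` is open and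
`t ⊆ U` is a finite set generating a dense subgroup of `U`, then `t` together with a (finite) set of
representatives of `G/U` generates a dense subgroup of `G`: its closure `C` contains `U` and a
representative of every coset, hence every element.
[cite: MochizukiAbsTopI2012, Prop 1.3 (ii) p.12] -/
theorem IsTopologicallyFinitelyGenerated.of_subgroup_of_isOpen [CompactSpace G] (U : Subgroup G)
    (hU : IsOpen (U : Set G)) (hUt : IsTopologicallyFinitelyGenerated U) :
    IsTopologicallyFinitelyGenerated G := by
  classical
  obtain ⟨t, ht⟩ := hUt.exists_finset
  haveI : Finite (G ⧸ U) := Subgroup.quotient_finite_of_isOpen U hU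
  haveI : Fintype (G ⧸ U) := Fintype.ofFinite _
  let R : Finset G := Finset.univ.image (fun q : G ⧸ U => q.out)
  let s : Finset G := t.image (fun x : U => (x : G)) ∪ R
  refine ⟨⟨s, ?_⟩⟩
  set C : Subgroup G := (Subgroup.closure (s : Set G)).topologicalClosure with hC
  -- (1) `U ≤ C`: push the dense subgroup of `U` generated by `t` forward along `U ↪ G`.
  have hmap : ((Subgroup.closure (t : Set U)).map U.subtype : Subgroup G) ≤
      Subgroup.closure (s : Set G) := by
    rw [MonoidHom.map_closure]
    apply Subgroup.closure_mono
    rintro _ ⟨x, hx, rfl⟩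
    exact Finset.mem_coe.mpr
      (Finset.mem_union_left _ (Finset.mem_image_of_mem (fun x : U => (x : G)) (Finset.mem_coe.mp hx)))
  have hUC : U ≤ C := by
    intro u hu
    have h1 : (⟨u, hu⟩ : U) ∈ ((Subgroup.closure (t : Set U)).topologicalClosure : Set U) := by
      rw [ht]; trivial
    rw [Subgroup.topologicalClosure_coe] at h1
    have h2 : u ∈ closure ((fun x : U => (x : G)) '' ((Subgroup.closure (t : Set U) : Subgroup U) : Set U)) :=
      image_closure_subset_closure_image continuous_subtype_val ⟨⟨u, hu⟩, h1, rfl⟩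
    have h3 : (fun x : U => (x : G)) '' ((Subgroup.closure (t : Set U) : Subgroup U) : Set U) ⊆
        (Subgroup.closure (s : Set G) : Set G) := by
      rw [show (fun x : U => (x : G)) = U.subtype from rfl, ← Subgroup.coe_map]
      exact SetLike.coe_subset_coe.mpr hmap
    rw [hC, ← SetLike.mem_coe, Subgroup.topologicalClosure_coe]
    exact closure_mono h3 h2
  -- (2) every element is (a representative in `R`) · (an element of `U`).
  rw [eq_top_iff]
  intro g _
  have hR : (g : G ⧸ U).out ∈ C := by
    apply Subgroup.le_topologicalClosure
    apply Subgroup.subset_closure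
    exact Finset.mem_coe.mpr (Finset.mem_union_right _
      (Finset.mem_image_of_mem (fun q : G ⧸ U => q.out) (Finset.mem_univ _)))
  have hmem : ((g : G ⧸ U).out)⁻¹ * g ∈ U := by
    rw [← QuotientGroup.eq, QuotientGroup.out_eq']
  have := C.mul_mem hR (hUC hmem)
  rwa [mul_inv_cancel_left] at this

/-- **[AbsTopI] Prop 1.3 (ii), necessity**: in a very elastic compact group, every topologically
finitely generated closed normal subgroup `N ⊆ H` of an open subgroup `H ⊆ G` is trivial.  (By
elasticity `N = 1` or `[G : N] < ∞`; in the second case `N` is a topologically finitely generated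
OPEN subgroup, so `G` would be topologically finitely generated, contradicting "very elastic".)
[cite: MochizukiAbsTopI2012, Prop 1.3 (ii) p.12] -/
theorem IsVeryElastic.eq_bot_of_isOpen [CompactSpace G] (h : IsVeryElastic G)
    (H N : Subgroup G) (hH : IsOpen (H : Set G)) (hNH : N ≤ H) (hn : (N.subgroupOf H).Normal)
    (hNc : IsClosed (N : Set G)) (hNt : IsTopologicallyFinitelyGenerated N) : N = ⊥ := by
  rcases h.isElastic.eq_bot_or_finiteIndex H N hH hNH hn hNc hNt with h0 | hfi
  · exact h0
  · exfalso
    haveI := hfi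
    have hNo : IsOpen (N : Set G) := Subgroup.isOpen_of_isClosed_of_finiteIndex N hNc
    exact h.not_tfg (IsTopologicallyFinitelyGenerated.of_subgroup_of_isOpen N hNo hNt)

/-- **[AbsTopI] Prop 1.3 (ii), sufficiency**: a non-trivial group in which every topologically
finitely generated closed normal subgroup `N ⊆ H` of an open subgroup `H ⊆ G` is trivial is very
elastic (elastic trivially; not topologically finitely generated by taking `H = N = G ≠ {1}`).
[cite: MochizukiAbsTopI2012, Prop 1.3 (ii) p.12] -/
theorem isVeryElastic_of_forall_eq_bot [Nontrivial G]
    (h : ∀ (H N : Subgroup G), IsOpen (H : Set G) → N ≤ H → (N.subgroupOf H).Normal →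
      IsClosed (N : Set G) → IsTopologicallyFinitelyGenerated N → N = ⊥) :
    IsVeryElastic G := by
  refine ⟨⟨fun H N hH hNH hn hNc hNt => Or.inl (h H N hH hNH hn hNc hNt)⟩, fun htfg => ?_⟩
  have hnorm : ((⊤ : Subgroup G).subgroupOf ⊤).Normal := by
    rw [Subgroup.subgroupOf_self]; infer_instance
  let e : G ≃ₜ* (⊤ : Subgroup G) :=
    { toFun := fun g => ⟨g, Subgroup.mem_top g⟩
      invFun := fun x => (x : G)
      left_inv := fun _ => rfl
      right_inv := fun _ => rfl
      map_mul' := fun _ _ => rfl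
      continuous_toFun := continuous_id.subtype_mk _
      continuous_invFun := continuous_subtype_val }
  have htop : IsTopologicallyFinitelyGenerated (⊤ : Subgroup G) := htfg.of_continuousMulEquiv e
  have := h ⊤ ⊤ (by simp) le_rfl hnorm (by simp) htop
  exact top_ne_bot this

/-- **[AbsTopI] Prop 1.3 (ii)**: "Suppose that `G` is nontrivial. Then `G` is very elastic if and
only if it holds that every topologically finitely generated closed normal subgroup `N ⊆ H` of an
open subgroup `H ⊆ G` of `G` is trivial" — for compact (profinite, in print) non-trivial `G`.
[cite: MochizukiAbsTopI2012, Prop 1.3 (ii) p.12] -/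
theorem isVeryElastic_iff_forall_eq_bot [CompactSpace G] [Nontrivial G] :
    IsVeryElastic G ↔ ∀ (H N : Subgroup G), IsOpen (H : Set G) → N ≤ H → (N.subgroupOf H).Normal →
      IsClosed (N : Set G) → IsTopologicallyFinitelyGenerated N → N = ⊥ :=
  ⟨fun h H N => h.eq_bot_of_isOpen H N, isVeryElastic_of_forall_eq_bot⟩

end Literature.AnabelianGeometry.AbsoluteAnabelian

end
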